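import Mathlib
import HarnessLib
import Summits.HubbardSuperconductivity.HubbardSuperconductivity.Theorems.KLProgrammeKLRegimeThinPairFlow
import Summits.HubbardSuperconductivity.HubbardSuperconductivity.Theorems.KLProgrammeKLRegimeThinOverlapIncrementRowsTnorm

/-!
# K3 VL child `KLRegimeVolumeLimitV17F2` (stmt-HubbardSuperconductivity-20440), located item #23 «W2-HALF-VL», brick «W2H-OVL» part 23 (THE PIECES):
# the (R-row/col) pieces of the transfer telescope in the `Λ_T`-currency — `χ i ≤ C_T·4^{2(k+1)+5}·(ΣGfr+1)U/4^i` along the flow chain, `D_w = 1`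

Cell `gate-hubbard-kl`, seat p3 (g15), lead of #23.  `charSumWt_thinPairDiff_flow` (part 22) ∘ `rowSumTn_/colSumTn_klReanalysis_sub_le_of_rates` (part 15, weight
domination constant `D_w = 1` because `Λ_T ≤ ρ/4^i`) ∘ a closed-form majorant of the per-piece bound (`1/s₀ + 1 ≤ 2MπΘ_c/(Λ_{k+1}β)`, `N^Δ ≤ 2β c_N V²`,
`𝔅₀⁽¹⁾ + 𝔅₀⁽²⁾ ≤ 10de₀²G₀/(Λ_{k+1}x²)`; the factors `M`, `β`, `V` cancel against `ε = β/2M` and `1/(βV²)`):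

* `thinPair_rhs_majorant` — the real-arithmetic majorant;
* **`rowColSumTn_klReanalysis_sub_flow`** — `∃ C_T ρ_t > 0` (absolute) such that along every admissible history, on every lattice `V` (`klEngL₃ ≤ V`), for
  `2(k+1)+5 ≤ i`, `i+1 ≤ n`, `0 ≤ Λ_T`, `Λ_T·4^i ≤ ρ_t`: the `(1 + Λ_T·tnorm)`-weighted rows of `klReanalysis_V[K_{i+1}] k − klReanalysis_V[K_i] k` are
  `≤ C_T·4^{2(k+1)+5}·((Gfr₀+Gfr₁+Gfr₂+Gfr₃+1)U)/4^i` and the columns `≤` twice that — the `χ i, χ′ i` of `transferWtData_klTowerTransfer_flow_of_pieces_tn`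
  with `Σ_{i ≥ m₀} χ i ≤ (4/3)·C_T·4^{2(k+1)+5−m₀}·(ΣGfr+1)U ≤ (4/3)·C_T·(ΣGfr+1)U` (k-uniform, U-small) for `m₀ ≥ 2(k+1)+5`.

No definitions, no sorry.  Nothing asserts any stub, K3, VL or superconductivity. [cite: BenfattoGiulianiMastropietro2006, §2.7 (2.70)–(2.71a), §3 (3.2)–(3.8)]
-/

noncomputable section

namespace Summit.HubbardSuperconductivity.HubbardSuperconductivity.Theorems.TorusFourierL2

set_option linter.dupNamespace false -- summit = problem name (single-conjunct summit), D-0017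

open Set Finset Filter Topology Literature.MathematicalPhysics.QuantumLattice Literature.MathematicalPhysics.QuantumLattice.BandSectorCounting
open Literature.MathematicalPhysics.QuantumLattice.FermiRG Literature.Probability.LatticeModels Literature.Analysis.SpecialFunctions Literature.Analysis.Calculus
open Summit.HubbardSuperconductivity.HubbardSuperconductivity.Theorems.DispersionFlow
open Summit.HubbardSuperconductivity.HubbardSuperconductivity.Theorems.KLRegimeSplit
open Summit.HubbardSuperconductivity.HubbardSuperconductivity.Theorems.KLProgrammeLegKernels
open Summit.HubbardSuperconductivity.HubbardSuperconductivity.Theorems.PerturbedFermiCurve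
open Summit.HubbardSuperconductivity.HubbardSuperconductivity.Theorems.EngineV8
open Summit.HubbardSuperconductivity.HubbardSuperconductivity.Theorems.TwoVolumeSource
open scoped Real Nat

open Classical

set_option maxHeartbeats 1600000 in
/-- **Closed-form majorant of the per-piece bound** (pure real arithmetic): in the regime `1 ≤ x`, `0 < Λ₁ ≤ 1`, `Λ₁ ≤ Λ₀`, `2 ≤ β ≤ M`, `1 ≤ V`,
`s₀ = Λ₁β/(MπΘ_c)`, `1 ≤ Θ_c`, `0 ≤ r_a ≤ r̄`, `G₀/x² ≤ Λ₁`, the right-hand side of `charSumWt_thinPairDiff_flow` is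
`≤ M·V²·(10·d·e₀²·√(524288·W_ρ·(2πΘ_c)·(96·c_N))·(1/Λ₁)²·G₀/x)`, `c_N = (√2c̄₁/π + 2)(2√2r̄/π + 2)`, `c̄₁ = (1 + (4+4A)r̄²)/(2ρ_min − 4A)`. [folklore] -/
theorem thinPair_rhs_majorant {M V : ℕ} {x Λ₁ Λ₀ β s₀ Θc Wρ A ra rbar rhomin d e₀ G₀ : ℝ} (hx : 1 ≤ x) (hΛ₁ : 0 < Λ₁) (hΛ₁1 : Λ₁ ≤ 1)
    (hΛ₀₁ : Λ₁ ≤ Λ₀) (hβ2 : 2 ≤ β) (hβM : β ≤ M) (hV : (1 : ℝ) ≤ V) (hs₀ : s₀ = Λ₁ * β / (M * π * Θc)) (hΘc : 1 ≤ Θc) (hW : 0 ≤ Wρ)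
    (hA : 0 ≤ A) (hrho : 0 < 2 * rhomin - 4 * A) (hra0 : 0 ≤ ra) (hra : ra ≤ rbar) (hd : 0 ≤ d) (hG₀ : 0 ≤ G₀) (hGΛ : G₀ / x ^ 2 ≤ Λ₁) :
    x * Real.sqrt (524288 * (1 / s₀ + 1) * Wρ) *
        Real.sqrt (24 * (2 * M : ℕ) * (V : ℝ) ^ 2 *
          (2 * ((Λ₁ * β / π + 1) *
            ((Real.sqrt 2 * V * ((Λ₁ + (4 + 4 * A) * ra ^ 2) / (2 * rhomin - 4 * A)) / π + 2) * (Real.sqrt 2 * V * (2 * ra) / π + 2))))) *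
        ((d * e₀ ^ 2 / Λ₁ ^ 2 * (G₀ / x ^ 2 * (2 * (Λ₁ + G₀ / x ^ 2) + G₀ / x ^ 2))) +
          (d * e₀ ^ 2 / Λ₀ ^ 2 * (G₀ / x ^ 2 * (2 * (Λ₀ + G₀ / x ^ 2) + G₀ / x ^ 2)))) ≤
      M * (V : ℝ) ^ 2 * (10 * d * e₀ ^ 2 *
        Real.sqrt (524288 * Wρ * (2 * π * Θc) * (96 * ((Real.sqrt 2 * ((1 + (4 + 4 * A) * rbar ^ 2) / (2 * rhomin - 4 * A)) / π + 2) *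
          (2 * Real.sqrt 2 * rbar / π + 2)))) * (1 / Λ₁) ^ 2 * G₀ / x) := by
  have hπ := Real.pi_pos
  have hπ3 := Real.pi_gt_three
  have hx0 : 0 < x := lt_of_lt_of_le one_pos hx
  have hβ0 : 0 < β := lt_of_lt_of_le two_pos hβ2
  have hM0 : (0 : ℝ) < M := lt_of_lt_of_le hβ0 hβM
  have hV0 : (0 : ℝ) < V := lt_of_lt_of_le one_pos hV
  have hΘ0 : 0 < Θc := lt_of_lt_of_le one_pos hΘc
  have hΛ₀ : 0 < Λ₀ := lt_of_lt_of_le hΛ₁ hΛ₀₁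
  have hrbar0 : 0 ≤ rbar := hra0.trans hra
  have hY₁ : 1 ≤ 1 / Λ₁ := by rw [le_div_iff₀ hΛ₁]; linarith
  set Y₁ : ℝ := 1 / Λ₁ with hY₁def
  have hY0 : 0 ≤ Y₁ := zero_le_one.trans hY₁
  set cb : ℝ := (1 + (4 + 4 * A) * rbar ^ 2) / (2 * rhomin - 4 * A) with hcb
  set cN : ℝ := (Real.sqrt 2 * cb / π + 2) * (2 * Real.sqrt 2 * rbar / π + 2) with hcN
  have hcb0 : 0 ≤ cb := by rw [hcb]; positivity
  have hcN0 : 0 ≤ cN := by rw [hcN]; positivity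
  -- (1) the time-rate factor: `1/s₀ + 1 ≤ 2MπΘ_c·Y₁/β`
  have hs₀pos : 0 < s₀ := by rw [hs₀]; positivity
  have hs₀1 : s₀ ≤ 1 := by
    rw [hs₀, div_le_one (by positivity)]
    have h1 : Λ₁ * β ≤ 1 * (M : ℝ) := mul_le_mul hΛ₁1 hβM hβ0.le zero_le_one
    have h2 : (M : ℝ) * 1 * 1 ≤ M * π * Θc := by gcongr; linarith
    linarith
  have hinv : 1 / s₀ = M * π * Θc * Y₁ / β := by rw [hs₀, hY₁def]; field_simp
  have hW₁ : 524288 * (1 / s₀ + 1) * Wρ ≤ 524288 * Wρ * (2 * π * Θc) * (M * Y₁ / β) := by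
    have h2 : 1 / s₀ + 1 ≤ 2 * (1 / s₀) := by
      have : 1 ≤ 1 / s₀ := by rw [le_div_iff₀ hs₀pos]; linarith
      linarith
    calc 524288 * (1 / s₀ + 1) * Wρ ≤ 524288 * (2 * (1 / s₀)) * Wρ := by gcongr
      _ = 524288 * Wρ * (2 * π * Θc) * (M * Y₁ / β) := by rw [hinv]; ring
  -- (2) the count: `N^Δ ≤ 2β·c_N·V²`
  have hc₁ : (Λ₁ + (4 + 4 * A) * ra ^ 2) / (2 * rhomin - 4 * A) ≤ cb := by
    rw [hcb]; refine div_le_div_of_nonneg_right ?_ hrho.le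
    have : ra ^ 2 ≤ rbar ^ 2 := pow_le_pow_left₀ hra0 hra 2
    nlinarith only [hΛ₁1, this, hA]
  have hc₁0 : 0 ≤ (Λ₁ + (4 + 4 * A) * ra ^ 2) / (2 * rhomin - 4 * A) := by positivity
  have hP₁ : Real.sqrt 2 * V * ((Λ₁ + (4 + 4 * A) * ra ^ 2) / (2 * rhomin - 4 * A)) / π + 2 ≤ (Real.sqrt 2 * cb / π + 2) * V := by
    have h1 : Real.sqrt 2 * V * ((Λ₁ + (4 + 4 * A) * ra ^ 2) / (2 * rhomin - 4 * A)) / π ≤ Real.sqrt 2 * V * cb / π := by gcongr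
    have h2 : (2 : ℝ) ≤ 2 * V := by linarith
    calc _ ≤ Real.sqrt 2 * V * cb / π + 2 * V := add_le_add h1 h2
      _ = (Real.sqrt 2 * cb / π + 2) * V := by ring
  have hP₂ : Real.sqrt 2 * V * (2 * ra) / π + 2 ≤ (2 * Real.sqrt 2 * rbar / π + 2) * V := by
    have h1 : Real.sqrt 2 * V * (2 * ra) / π ≤ Real.sqrt 2 * V * (2 * rbar) / π := by gcongr
    have h2 : (2 : ℝ) ≤ 2 * V := by linarith
    calc _ ≤ Real.sqrt 2 * V * (2 * rbar) / π + 2 * V := add_le_add h1 h2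
      _ = (2 * Real.sqrt 2 * rbar / π + 2) * V := by ring
  have hP₁0 : 0 ≤ Real.sqrt 2 * V * ((Λ₁ + (4 + 4 * A) * ra ^ 2) / (2 * rhomin - 4 * A)) / π + 2 := by positivity
  have hP₂0 : 0 ≤ Real.sqrt 2 * V * (2 * ra) / π + 2 := by positivity
  have hLβ : Λ₁ * β / π + 1 ≤ β := by
    have h1 : Λ₁ * β / π ≤ β / 2 := by
      rw [div_le_div_iff₀ hπ two_pos]; nlinarith only [hΛ₁1, hβ0, hπ3]
    linarith
  have hLβ0 : 0 ≤ Λ₁ * β / π + 1 := by positivity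
  have hN : 2 * ((Λ₁ * β / π + 1) * ((Real.sqrt 2 * V * ((Λ₁ + (4 + 4 * A) * ra ^ 2) / (2 * rhomin - 4 * A)) / π + 2) *
      (Real.sqrt 2 * V * (2 * ra) / π + 2))) ≤ 2 * (β * (cN * (V : ℝ) ^ 2)) := by
    have hPP : (Real.sqrt 2 * V * ((Λ₁ + (4 + 4 * A) * ra ^ 2) / (2 * rhomin - 4 * A)) / π + 2) * (Real.sqrt 2 * V * (2 * ra) / π + 2) ≤
        cN * (V : ℝ) ^ 2 := by
      calc _ ≤ ((Real.sqrt 2 * cb / π + 2) * V) * ((2 * Real.sqrt 2 * rbar / π + 2) * V) := mul_le_mul hP₁ hP₂ hP₂0 (by positivity)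
        _ = cN * (V : ℝ) ^ 2 := by rw [hcN]; ring
    have := mul_le_mul hLβ hPP (by positivity) hβ0.le
    linarith
  have hW₂ : 24 * (2 * M : ℕ) * (V : ℝ) ^ 2 * (2 * ((Λ₁ * β / π + 1) *
      ((Real.sqrt 2 * V * ((Λ₁ + (4 + 4 * A) * ra ^ 2) / (2 * rhomin - 4 * A)) / π + 2) * (Real.sqrt 2 * V * (2 * ra) / π + 2)))) ≤
      96 * cN * (M * β * (V : ℝ) ^ 4) := by
    push_cast
    have h0 : 0 ≤ 24 * (2 * (M : ℝ)) * (V : ℝ) ^ 2 := by positivity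
    calc _ ≤ 24 * (2 * (M : ℝ)) * (V : ℝ) ^ 2 * (2 * (β * (cN * (V : ℝ) ^ 2))) := mul_le_mul_of_nonneg_left hN h0
      _ = 96 * cN * (M * β * (V : ℝ) ^ 4) := by ring
  -- (3) the product of the square roots
  set K : ℝ := 524288 * Wρ * (2 * π * Θc) * (96 * cN) with hK
  have hK0 : 0 ≤ K := by rw [hK]; positivity
  have hsq : Real.sqrt (524288 * (1 / s₀ + 1) * Wρ) *
      Real.sqrt (24 * (2 * M : ℕ) * (V : ℝ) ^ 2 * (2 * ((Λ₁ * β / π + 1) *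
        ((Real.sqrt 2 * V * ((Λ₁ + (4 + 4 * A) * ra ^ 2) / (2 * rhomin - 4 * A)) / π + 2) * (Real.sqrt 2 * V * (2 * ra) / π + 2))))) ≤
      Real.sqrt K * Y₁ * (M * (V : ℝ) ^ 2) := by
    have h1 := Real.sqrt_le_sqrt hW₁
    have h2 := Real.sqrt_le_sqrt hW₂
    have h12 := mul_le_mul h1 h2 (Real.sqrt_nonneg _) (Real.sqrt_nonneg _)
    refine h12.trans ?_
    rw [← Real.sqrt_mul (by positivity)]
    have e : 524288 * Wρ * (2 * π * Θc) * (M * Y₁ / β) * (96 * cN * (M * β * (V : ℝ) ^ 4)) = (K * Y₁) * (M * (V : ℝ) ^ 2) ^ 2 := by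
      rw [hK]; field_simp
    rw [e, Real.sqrt_mul (by positivity), Real.sqrt_sq (by positivity), Real.sqrt_mul hK0]
    have hsY : Real.sqrt Y₁ ≤ Y₁ := by
      rw [Real.sqrt_le_left hY0]; nlinarith only [hY₁]
    have := mul_le_mul_of_nonneg_left hsY (Real.sqrt_nonneg K)
    exact mul_le_mul_of_nonneg_right this (by positivity)
  -- (4) the amplitude: `B₀⁽¹⁾ + B₀⁽²⁾ ≤ 10·d·e₀²·Y₁·G₀/x²`
  have hg0 : 0 ≤ G₀ / x ^ 2 := by positivity
  have hB₁ : d * e₀ ^ 2 / Λ₁ ^ 2 * (G₀ / x ^ 2 * (2 * (Λ₁ + G₀ / x ^ 2) + G₀ / x ^ 2)) ≤ 5 * (d * e₀ ^ 2) * Y₁ * (G₀ / x ^ 2) := by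
    have h5 : 2 * (Λ₁ + G₀ / x ^ 2) + G₀ / x ^ 2 ≤ 5 * Λ₁ := by linarith only [hGΛ]
    calc _ ≤ d * e₀ ^ 2 / Λ₁ ^ 2 * (G₀ / x ^ 2 * (5 * Λ₁)) := by gcongr
      _ = 5 * (d * e₀ ^ 2) * Y₁ * (G₀ / x ^ 2) := by rw [hY₁def]; field_simp
  have hB₂ : d * e₀ ^ 2 / Λ₀ ^ 2 * (G₀ / x ^ 2 * (2 * (Λ₀ + G₀ / x ^ 2) + G₀ / x ^ 2)) ≤ 5 * (d * e₀ ^ 2) * Y₁ * (G₀ / x ^ 2) := by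
    have hGΛ₀ : G₀ / x ^ 2 ≤ Λ₀ := hGΛ.trans hΛ₀₁
    have h5 : 2 * (Λ₀ + G₀ / x ^ 2) + G₀ / x ^ 2 ≤ 5 * Λ₀ := by linarith only [hGΛ₀]
    have hY' : 1 / Λ₀ ≤ Y₁ := by rw [hY₁def]; exact one_div_le_one_div_of_le hΛ₁ hΛ₀₁
    calc _ ≤ d * e₀ ^ 2 / Λ₀ ^ 2 * (G₀ / x ^ 2 * (5 * Λ₀)) := by gcongr
      _ = 5 * (d * e₀ ^ 2) * (1 / Λ₀) * (G₀ / x ^ 2) := by field_simp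
      _ ≤ 5 * (d * e₀ ^ 2) * Y₁ * (G₀ / x ^ 2) := by gcongr
  have hB : (d * e₀ ^ 2 / Λ₁ ^ 2 * (G₀ / x ^ 2 * (2 * (Λ₁ + G₀ / x ^ 2) + G₀ / x ^ 2))) +
      (d * e₀ ^ 2 / Λ₀ ^ 2 * (G₀ / x ^ 2 * (2 * (Λ₀ + G₀ / x ^ 2) + G₀ / x ^ 2))) ≤ 10 * (d * e₀ ^ 2) * Y₁ * (G₀ / x ^ 2) := by
    linarith only [hB₁, hB₂]
  have hB0 : 0 ≤ (d * e₀ ^ 2 / Λ₁ ^ 2 * (G₀ / x ^ 2 * (2 * (Λ₁ + G₀ / x ^ 2) + G₀ / x ^ 2))) +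
      (d * e₀ ^ 2 / Λ₀ ^ 2 * (G₀ / x ^ 2 * (2 * (Λ₀ + G₀ / x ^ 2) + G₀ / x ^ 2))) := by positivity
  -- assemble
  calc _ ≤ x * (Real.sqrt K * Y₁ * (M * (V : ℝ) ^ 2)) * (10 * (d * e₀ ^ 2) * Y₁ * (G₀ / x ^ 2)) := by
        rw [mul_assoc x]
        exact mul_le_mul (mul_le_mul_of_nonneg_left hsq hx0.le) hB hB0 (by positivity)
    _ = M * (V : ℝ) ^ 2 * (10 * d * e₀ ^ 2 * Real.sqrt K * (1 / Λ₁) ^ 2 * G₀ / x) := by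
        rw [hY₁def]; field_simp


set_option maxHeartbeats 4000000 in -- long statements (two flow frames, the per-piece bound) and the row/column packaging
/-- **The (R-row/col) pieces of the transfer telescope in the `Λ_T`-currency along the flow chain** (see the module docstring).
[cite: BenfattoGiulianiMastropietro2006, §2.7 (2.70)–(2.71a), §3 (3.2)–(3.8)] -/
theorem rowColSumTn_klReanalysis_sub_flow :
    ∃ CT ρt : ℝ, 0 < CT ∧ 0 < ρt ∧
      ∀ (G : GeoConsts) (P : SplitConsts) (R : RenConsts) (Qe : EngConsts) (cc : ℝ), R.WF2 → 0 < cc → cc ≤ EngineV8.klEngC₃6 P R →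
      ∀ μ ∈ klWindowC, ∀ U : ℝ, 0 < U → U ≤ min (EngineV8.klEngU₀3 P R cc) (1 / (R.Gfr 3 + 1)) →
      ∀ β : ℝ, klBetaMin ≤ β → β ≤ Real.exp (cc / U ^ 2) →
      ∀ (L M : ℕ) [NeZero L] [NeZero M], EngineV8.klEngL₃ β U ≤ L → EngineV8.klEngM₃ β U L ≤ M →
      ∀ n : ℕ, n ≤ nScales β + 1 → HistP klPredsV17F2 L M G P Qe R β U μ 0 n →
        ∀ (V : ℕ) [NeZero V], EngineV8.klEngL₃ β U ≤ V →
        ∀ k i : ℕ, 2 * (k + 1) + 5 ≤ i → i + 1 ≤ n → ∀ ΛT : ℝ, 0 ≤ ΛT → ΛT * (4 : ℝ) ^ i ≤ ρt →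
        (∀ X'' : SpaceTimeIdx V M × SectorLeg (sectorCount (k + 1)), ∑ X' : SpaceTimeIdx V M × SectorLeg (sectorCount k),
          ‖(klReanalysis V M β μ (klFlowFrameU L M β U μ (i + 1)) k - klReanalysis V M β μ (klFlowFrameU L M β U μ i) k) X'' X'‖ *
            (1 + ΛT * (Torus.tnorm (X''.1.2 - X'.1.2) : ℝ)) ≤ CT * (4 : ℝ) ^ (2 * (k + 1) + 5) * ((R.Gfr 0 + R.Gfr 1 + R.Gfr 2 + R.Gfr 3 + 1) * U) / (4 : ℝ) ^ i) ∧
        (∀ X' : SpaceTimeIdx V M × SectorLeg (sectorCount k), ∑ X'' : SpaceTimeIdx V M × SectorLeg (sectorCount (k + 1)),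
          ‖(klReanalysis V M β μ (klFlowFrameU L M β U μ (i + 1)) k - klReanalysis V M β μ (klFlowFrameU L M β U μ i) k) X'' X'‖ *
            (1 + ΛT * (Torus.tnorm (X''.1.2 - X'.1.2) : ℝ)) ≤ 2 * (CT * (4 : ℝ) ^ (2 * (k + 1) + 5) * ((R.Gfr 0 + R.Gfr 1 + R.Gfr 2 + R.Gfr 3 + 1) * U) / (4 : ℝ) ^ i)) := by
  have ha : (-4 : ℝ) < -(6 / 5) := by norm_num
  have hab : (-(6 / 5) : ℝ) ≤ -(1 / 10) := by norm_num
  have hb : (-(1 / 10) : ℝ) < 0 := by norm_num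
  obtain ⟨d, Ba, Q, Θc, A, hd0, -, hQ0, hΘc1, hA0, hADt, hρA, hflow⟩ := charSumWt_thinPairDiff_flow ha hab hb
  set B : BandBounds (-(6 / 5)) (-(1 / 10)) := bandBounds ha hab hb with hBdef
  have hπ := Real.pi_pos
  have hDtA : 0 < B.Dtmin - 2 * A := by linarith only [hADt]
  have hrho : 0 < 2 * B.rhomin - 4 * A := by linarith only [hρA]
  have hsm := B.smax_pos
  have hDt0 := B.Dtmin_pos
  -- the absolute constants
  obtain ⟨rbar, hrbar⟩ : ∃ y : ℝ, y = (klE0 + B.smax * B.Dtmin * (3 * π / 4)) / (B.Dtmin - 2 * A) := ⟨_, rfl⟩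
  obtain ⟨Wρ, hWρ⟩ : ∃ y : ℝ, y = (1 + 4 * Real.sqrt 2) ^ 2 * ((2 * Real.sqrt 2 / (1 / (4 * (Q + 1))) + 2) * (2 * Real.sqrt 2 / (1 / (4 * (Q + 1))) + 2)) +
      (1 / (1 / (4 * (Q + 1))) + 1) ^ 2 := ⟨_, rfl⟩
  obtain ⟨K, hK⟩ : ∃ y : ℝ, y = 524288 * Wρ * (2 * π * Θc) * (96 * ((Real.sqrt 2 * ((1 + (4 + 4 * A) * rbar ^ 2) / (2 * B.rhomin - 4 * A)) / π + 2) *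
      (2 * Real.sqrt 2 * rbar / π + 2))) := ⟨_, rfl⟩
  have hQ1 : 0 < Q + 1 := by linarith only [hQ0]
  have he : (0 : ℝ) < klE0 := by norm_num [klE0]
  have hWρ0 : 0 ≤ Wρ := by rw [hWρ]; positivity
  have hrbar0 : 0 ≤ rbar := by rw [hrbar]; exact div_nonneg (by positivity) hDtA.le
  have hK0 : 0 ≤ K := by rw [hK]; have := zero_le_one.trans hΘc1; positivity
  refine ⟨810 * d * klE0 ^ 2 * Real.sqrt K + 1, 1 / (4 * (Q + 1)), by positivity, by positivity, ?_⟩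
  intro G P R Qe cc hR2 hcc hcc6 μ hμ U hU hUle β hβmin hβc L M _ _ hL3 hM3 n hnN hhist V _ hV3 k i hki hin ΛT hΛT hΛTρ
  -- the per-piece bound along the flow, every pair
  have hT := fun (ω₁ : Fin (sectorCount (k + 1))) (a' : Fin (sectorCount k)) =>
    hflow G P R Qe cc hR2 hcc hcc6 μ hμ U hU hUle β hβmin hβc L M hL3 hM3 n hnN hhist V hV3 k i hki hin ω₁ a'
  -- regime scalars
  have hRj : ∀ j, 0 ≤ R.Gfr j := EngineV8.gfr_nonneg_of_wf2 hR2
  have hβ0 : 0 < β := pos_of_klBetaMin_le hβmin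
  have hβ2 : 2 ≤ β := le_trans (by norm_num [klBetaMin]) hβmin
  have hMβ : β ≤ (M : ℝ) := EngineV8.le_of_klEngM₃_le hβmin hL3 hM3
  have hM0 : (0 : ℝ) < M := lt_of_lt_of_le hβ0 hMβ
  have hVβ : β ^ 2 ≤ (V : ℝ) := EngineV8.sq_le_of_klEngL₃_le hV3
  have hV1 : (1 : ℝ) ≤ V := le_trans (by nlinarith only [hβ2]) hVβ
  have hΘc0 : 0 < Θc := lt_of_lt_of_le one_pos hΘc1
  obtain ⟨hΛ0pos, hΛ1pos, -, hΛ1le1, -, -, -, -, hY01, hYeq, -⟩ := thinPair_scale_facts k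
  have hΛ01 : klScale klE0 (k + 1) ≤ klScale klE0 k := (one_div_le_one_div hΛ0pos hΛ1pos).mp hY01
  have hU1 : U ≤ 1 := ((hUle.trans (min_le_left _ _)).trans (EngineV8.klEngU₀3_le_symbolU₀ ha hab hb P hRj cc)).trans (min_le_left _ _)
  have hGU : ∀ {j : ℕ}, j < 5 → R.Gfr j * U ≤ 1 / (2 : ℝ) ^ 120 := fun hj =>
    gfr_mul_le_of_le_klEngU₀3 P hU.le (hUle.trans (min_le_left _ _)) hj
  set G₀ : ℝ := (R.Gfr 0 + R.Gfr 1 + R.Gfr 2 + R.Gfr 3 + 1) * |U| with hG₀def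
  have hG₀0 : 0 ≤ G₀ := by rw [hG₀def]; have := hRj 0; have := hRj 1; have := hRj 2; have := hRj 3; positivity
  have hG₀2 : G₀ ≤ 2 := by
    rw [hG₀def, abs_of_pos hU]
    have h0 := hGU (j := 0) (by norm_num); have h1 := hGU (j := 1) (by norm_num); have h2 := hGU (j := 2) (by norm_num)
    have h3 := hGU (j := 3) (by norm_num)
    have h120 : (1 : ℝ) / 2 ^ 120 ≤ 1 / 4 := by norm_num
    nlinarith only [h0, h1, h2, h3, h120, hU1, hU]
  obtain ⟨-, hx1, hGΛ, -⟩ := thinPair_depth_facts hki hG₀2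
  have hx0 : (0 : ℝ) < (4 : ℝ) ^ i := by positivity
  have hRA0 : 0 ≤ (klScale klE0 (k + 1) + B.smax * B.Dtmin * (3 * sectorWidth k / 4)) / (B.Dtmin - 2 * A) := by
    have := sectorWidth_pos k; exact div_nonneg (by positivity) hDtA.le
  have hRA : (klScale klE0 (k + 1) + B.smax * B.Dtmin * (3 * sectorWidth k / 4)) / (B.Dtmin - 2 * A) ≤ rbar := by
    rw [hrbar]; refine div_le_div_of_nonneg_right ?_ hDtA.le
    have h1 : klScale klE0 (k + 1) ≤ klE0 := klScale_le_e0 (by norm_num [klE0]) (k + 1)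
    have h2 : sectorWidth k ≤ π := by
      show π / (2 : ℝ) ^ k ≤ π
      exact div_le_self hπ.le (one_le_pow₀ (by norm_num))
    nlinarith only [h1, h2, mul_pos hsm hDt0]
  -- the closed-form majorant of the per-piece bound
  have hWρ0' : 0 ≤ (1 + 4 * Real.sqrt 2) ^ 2 * ((2 * Real.sqrt 2 / (1 / (4 * (Q + 1))) + 2) * (2 * Real.sqrt 2 / (1 / (4 * (Q + 1))) + 2)) +
      (1 / (1 / (4 * (Q + 1))) + 1) ^ 2 := by positivity
  have hmaj := thinPair_rhs_majorant (M := M) (V := V) (e₀ := klE0) hx1 hΛ1pos hΛ1le1 hΛ01 hβ2 hMβ hV1 rfl hΘc1 hWρ0' hA0 hrho hRA0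
    hRA hd0 hG₀0 hGΛ
  have hT''' := fun (ω₁ : Fin (sectorCount (k + 1))) (a' : Fin (sectorCount k)) => (hT ω₁ a').trans hmaj
  rw [← hWρ, ← hK] at hT'''
  set T' : ℝ := M * (V : ℝ) ^ 2 * (10 * d * klE0 ^ 2 * Real.sqrt K * (1 / klScale klE0 (k + 1)) ^ 2 * G₀ / (4 : ℝ) ^ i) with hT'
  have hT'0 : 0 ≤ T' := by rw [hT']; positivity
  -- rates and domination with `D_w = 1`
  have hs₀0 : 0 ≤ klScale klE0 (k + 1) * β / (M * π * Θc) := by positivity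
  have hdom : ΛT ≤ 1 * ((1 / (4 * (Q + 1))) / (4 : ℝ) ^ i) := by
    rw [one_mul, le_div_iff₀ hx0]; exact hΛTρ
  -- the target constant
  have hfin : imagTimeWeight β M * (((27 : ℕ) + (27 : ℕ)) * (3 * (1 * T') / (β * (V : ℝ) ^ 2))) ≤
      (810 * d * klE0 ^ 2 * Real.sqrt K + 1) * (4 : ℝ) ^ (2 * (k + 1) + 5) * ((R.Gfr 0 + R.Gfr 1 + R.Gfr 2 + R.Gfr 3 + 1) * U) / (4 : ℝ) ^ i := by
    have hV0 : (0 : ℝ) < V := lt_of_lt_of_le one_pos hV1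
    have e : imagTimeWeight β M * (((27 : ℕ) + (27 : ℕ)) * (3 * (1 * T') / (β * (V : ℝ) ^ 2))) =
        810 * d * klE0 ^ 2 * Real.sqrt K * (1 / klScale klE0 (k + 1)) ^ 2 * G₀ / (4 : ℝ) ^ i := by
      rw [hT', imagTimeWeight]; push_cast; field_simp; ring
    rw [e]
    have hZ : 0 ≤ (4 : ℝ) ^ (2 * (k + 1) + 5) * ((R.Gfr 0 + R.Gfr 1 + R.Gfr 2 + R.Gfr 3 + 1) * U) / (4 : ℝ) ^ i := by
      have := hRj 0; have := hRj 1; have := hRj 2; have := hRj 3; positivity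
    have eL : 810 * d * klE0 ^ 2 * Real.sqrt K * (1 / klScale klE0 (k + 1)) ^ 2 * G₀ / (4 : ℝ) ^ i =
        (810 * d * klE0 ^ 2 * Real.sqrt K) * ((4 : ℝ) ^ (2 * (k + 1) + 5) * ((R.Gfr 0 + R.Gfr 1 + R.Gfr 2 + R.Gfr 3 + 1) * U) / (4 : ℝ) ^ i) := by
      rw [one_div_pow, hYeq, hG₀def, abs_of_pos hU]; ring
    have eR : (810 * d * klE0 ^ 2 * Real.sqrt K + 1) * (4 : ℝ) ^ (2 * (k + 1) + 5) * ((R.Gfr 0 + R.Gfr 1 + R.Gfr 2 + R.Gfr 3 + 1) * U) / (4 : ℝ) ^ i =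
        (810 * d * klE0 ^ 2 * Real.sqrt K + 1) * ((4 : ℝ) ^ (2 * (k + 1) + 5) * ((R.Gfr 0 + R.Gfr 1 + R.Gfr 2 + R.Gfr 3 + 1) * U) / (4 : ℝ) ^ i) := by
      ring
    rw [eL, eR]
    nlinarith only [hZ]
  refine ⟨fun X'' => ?_, fun X' => ?_⟩
  · exact (rowSumTn_klReanalysis_sub_le_of_rates (L := V) (M := M) hβ0 μ (klFlowFrameU L M β U μ i) (klFlowFrameU L M β U μ (i + 1)) k
      hT'0 hs₀0 (le_refl (1 : ℝ)) hΛT hdom hT''' X'').trans hfin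
  · have hcol := colSumTn_klReanalysis_sub_le_of_rates (L := V) (M := M) hβ0 μ (klFlowFrameU L M β U μ i) (klFlowFrameU L M β U μ (i + 1)) k
      hT'0 hs₀0 (le_refl (1 : ℝ)) hΛT hdom hT''' X'
    refine hcol.trans ?_
    have e : (((27 * 2 ^ (k + 1 - k) : ℕ) : ℝ) + ((27 * 2 ^ (k + 1 - k) : ℕ) : ℝ)) = 2 * (((27 : ℕ) : ℝ) + ((27 : ℕ) : ℝ)) := by
      rw [show k + 1 - k = 1 by omega]; push_cast; ring
    rw [e, mul_assoc (2 : ℝ), ← mul_assoc (imagTimeWeight β M) 2, mul_comm (imagTimeWeight β M) 2, mul_assoc (2 : ℝ)]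
    exact mul_le_mul_of_nonneg_left hfin (by norm_num)

end Summit.HubbardSuperconductivity.HubbardSuperconductivity.Theorems.TorusFourierL2

end
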